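import Summits.BirchSwinnertonDyer.BirchSwinnertonDyer.Theorems.CMKolyvaginAtInertTwoKolyvaginPrimeInertAtTwo
import Literature.NumberTheory.EllipticCurves.BSDSelmerPConverseYanZhuKolyvaginSystemProofs
import Literature.NumberTheory.EllipticCurves.HeegnerPointsOfConductorOneGaloisConjProofs
import HarnessLib

/-!
# Route `CMKolyvaginAtInertTwo`, crux `CMKolyvaginExactAtInertTwo` (stmt-BirchSwinnertonDyer-24277):
# the `τ`-part descent at `2` IN THE ROUTE'S CURRENCY — frame `Dt`, orientation `β`, embedding `ι`,
# conductor-`1` datum `d₁` with `y_K = d₁.derivedPoint ∈ E(K[1])`, and the item's `M₀ = 0` clause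

Seat `bsd-line-cmk2-p1` g6 (cell `bsd-print-cf2`); helper (`--supports stmt-BirchSwinnertonDyer-24277`).
THEOREMS ONLY: no definition, no named fact, no `sorry`; no item is closed; BSD is not proved by this.

The crux `CMKolyvaginExactAtInertTwo` (and the supply / KOLY₂ cruxes) speak of `y_K = P(1) =
d₁.derivedPoint ∈ E(K[1])` and of its `2`-divisibility in `E(K[1])` (`M₀`); the kernel Kolyvagin
machine and the `τ`-part descent at `2` (p608079, p608847, p609668) speak of a Heegner point
`P₀ ∈ E(K)` of level `N_E`. The seam is the tree's Galois descent
`heegnerSystem_exists_isHeegnerPoint_map_eq_derivedPoint_one` (with Shimura reciprocity at conductor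
`1`, `heegnerPointOfConductor_one_galoisConj_holds`): `P(1)` descends to some `P₀ ∈ E(K)` with
`IsHeegnerPoint N_E W K P₀`; and `y_K ∉ 2E(K[1])` (the item's clause at `M₀ = 0`) gives `P₀ ∉ 2E(K)`
by functoriality. Hence:

* `conjAct_eq_self_of_derivedPoint_one_not_two_divisible` — on H₂ (`W` globally minimal with CM,
  `CMInert W 2`, `ρ̄_{W,2}` onto), `K` imaginary quadratic with the Heegner hypothesis for `N_E`, for every
  frame `(Dt, β, ι, d₁)` with `¬ ∃ Q ∈ E(K[1]), 2Q = d₁.derivedPoint`: granted, for the `K`-points `P₀`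
  below `d₁.derivedPoint`, the machine's point-system DATA at `p = 2` and the reciprocity DATA (ty2
  p601266, support `CMInert W`, used at `M = 1`), **complex conjugation acts trivially on `Sel₂(E/K)`**.

References: [GrossLMS1991] §4 (4.1) (`P_1 = y_K`), Prop. 2.1 with §10; [Darmon2004] Thm. 3.7;
[McCallumLMS1991] §2 Prop. 2.2, §5 Lemma 5.3.
-/

-- single-conjunct summit: `Summit.BirchSwinnertonDyer.BirchSwinnertonDyer.…` repeats the name by design
set_option linter.dupNamespace false
set_option autoImplicit false

noncomputable section

open scoped Classical

namespace Summit.BirchSwinnertonDyer.BirchSwinnertonDyer.Theorems.KolyvaginDescentTwo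

open WeierstrassCurve NumberField
open Literature.NumberTheory.EllipticCurves Literature.NumberTheory.GaloisRepresentations
open Literature.NumberTheory.EllipticCurves.ModularForms
open Literature.NumberTheory.EllipticCurves.Rank1Residual

/-- **The `τ`-part descent at `2` in the route's currency.** `W/ℚ` globally minimal with CM, `2` inert
in `F` (`CMInert W 2`), `ρ̄_{W,2}` onto; `K` imaginary quadratic with the Heegner hypothesis for `N_E`
and conjugation `c ≠ 1`; a frame `Dt` (level `N_E`), `β`, `ι : K → ℂ` and a conductor-`1` Kolyvagin
datum `d₁` whose `y_K = d₁.derivedPoint` is NOT `2`-divisible in `E(K[1])` (the cruxes' clause at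
`M₀ = 0`). GRANTED, for every `P₀ ∈ E(K)` mapping to `y_K` in `E(K[1])`, a point-system family at
`p = 2` for `P₀` and a reciprocity family at `2`, both supported on the CM-inert Kolyvagin primes
(ty2's DATA; hypotheses at `2`, not print), **`c_* s = s` for every `s ∈ Sel₂(E/K)`** (level written
`2 ^ 1`). Proof: `P(1)` descends to a Heegner point `P₀ ∈ E(K)` of level `N_E`
(`heegnerSystem_exists_isHeegnerPoint_map_eq_derivedPoint_one`), `P₀ ∉ 2E(K)` by functoriality, and
`conjAct_eq_self_of_cmInert_families_two` (p609668). [cite: GrossLMS1991, §4 (4.1), Prop. 2.1 with §10]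
[cite: Darmon2004, Thm. 3.7] [cite: McCallumLMS1991, §2 Prop. 2.2, §5 Lemma 5.3] -/
theorem conjAct_eq_self_of_derivedPoint_one_not_two_divisible (W : WeierstrassCurve ℚ) [W.IsElliptic]
    [W.IsGloballyMinimal] [NeZero (W.conductorNorm ℤ)] (hCM : W.HasCM) (hin : CMInert W 2)
    (hsurj : W.HasSurjectiveModNGaloisRep 2) {K : Type} [Field K] [NumberField K]
    (hK : IsImaginaryQuadratic K) (hH : SatisfiesHeegnerHypothesis (W.conductorNorm ℤ) K)
    {Dt : ModularParametrizationData W (W.conductorNorm ℤ)} {β : ℤ} {ι : K →+* ℂ}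
    (d₁ : KolyvaginHeegnerData Dt β ι 1)
    (hndiv : ¬ ∃ Q : (W.baseChange (ringClassField K ι 1)).toAffine.Point, (2 : ℤ) • Q = d₁.derivedPoint)
    {c : K ≃ₐ[ℚ] K} (hc : c ≠ 1)
    (D : ∀ P₀ : (W.baseChange K).toAffine.Point,
      WeierstrassCurve.Affine.Point.map (W' := W) (algebraMap K (ringClassField K ι 1)).toRatAlgHom P₀ =
        d₁.derivedPoint →
      Rank1Residual.P2.KolyvaginMachine.PointSystemFamily (W.conductorNorm ℤ) W K P₀ 2 (CMInert W))
    (R : Rank1Residual.P2.KolyvaginMachine.ReciprocityFamily (W.conductorNorm ℤ) W K 2 (CMInert W)) :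
    ∀ s ∈ selmerGroup (W.baseChange K) ((2 ^ 1 : ℕ) : ℤ), conjAct W c ((2 ^ 1 : ℕ) : ℤ) s = s := by
  obtain ⟨P₀, hheeg, hP₀⟩ := heegnerSystem_exists_isHeegnerPoint_map_eq_derivedPoint_one
    (heegnerPointOfConductor_one_galoisConj_holds (W.conductorNorm ℤ) W K) hK hH d₁
  have hy : ∀ Q : (W.baseChange K).toAffine.Point, 2 • Q ≠ P₀ := by
    intro Q hQ
    refine hndiv ⟨WeierstrassCurve.Affine.Point.map (W' := W)
      (algebraMap K (ringClassField K ι 1)).toRatAlgHom Q, ?_⟩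
    rw [two_zsmul, ← map_add, ← two_nsmul, hQ, hP₀]
  exact conjAct_eq_self_of_cmInert_families_two W hCM hin hsurj hK hH hheeg hc hy (D P₀ hP₀) R

end Summit.BirchSwinnertonDyer.BirchSwinnertonDyer.Theorems.KolyvaginDescentTwo

end
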